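import Summits.PneNP.PneNP.Theorems.SzkEntropyPeaWorstToAvgStubOrbitKitANF
import Summits.PneNP.PneNP.Theorems.SzkEntropyPeaWorstToAvgOrbitPairRsrDefs
import HarnessLib

/-!
# Orbit kit for `orbit-pair-rsr`, II: the affine action on sparse cubic maps, symbolically

Helper file of the stub `stub_orbitKit` (crux `SzkEntropy.PeaWorstToAvg`, line `orbit-pair-rsr`).
The action `q ↦ (B·+c) ∘ q ∘ (A·+b)` of a pair of affine maps on a sparse cubic map, carried out on
the SPARSE PRESENTATION (lists of monomials with `ℕ`-indexed variables; matrices and vectors over `F₂`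
as lists of rows / entries):

* `ent`, `matT`, `vecT`, `ext` (lists as matrices / vectors / valuations), `evalM_untyped`;
* `affForm` (the affine form `xᵢ ↦ Σⱼ Aᵢⱼ xⱼ + bᵢ` as a sparse polynomial), `substMono`, `substP`
  (substitution into monomials of degree `≤ 3` via `RandPoly.mulP`), `mixP` (output mixing
  `i' ↦ Σᵢ B_{i'i} qᵢ + c_{i'}`), `transform`, and `outMap = canonM ∘ transform`;
* their values `evalP_affForm`, `evalP_substP`, `evalP_mixP`, and well-formedness (`transform_wf`,
  `outMap_wf`: indices `< s`, monomials of length `≤ 3`, on EVERY input).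
The typed bridge (`outMap` presents `affOut (matT B) (vecT c) (P.eval (matT A *ᵥ x + vecT b))`) is the
sequel `…StubOrbitKitBridge.lean`.

References: J. Patarin, EUROCRYPT 1996, §2 (isomorphism of polynomials with two secrets);
Dvir–Gutfreund–Rothblum–Vadhan, ICS 2011, §2 and pp. 2–3 (changes of variables).
-/

namespace Summit.PneNP.PneNP.Cruxes.PeaWorstToAvg.OrbitPairRsr

set_option linter.dupNamespace false -- Summit.PneNP.PneNP: summit = sub-problem (D-0017)

open Literature.Computability.Complexity RandPoly

namespace OKit

/-! ### Matrices and vectors as lists -/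

/-- Entry `(i, j)` of a matrix given by its rows (`0` outside). [folklore] -/
def ent (R : List (List (ZMod 2))) (i j : ℕ) : ZMod 2 := (R.getD i []).getD j 0

/-- The `s × s` matrix read off a list of rows. [folklore] -/
def matT (s : ℕ) (R : List (List (ZMod 2))) : Matrix (Fin s) (Fin s) (ZMod 2) :=
  Matrix.of fun i j => ent R i j

/-- The vector of length `s` read off a list of entries. [folklore] -/
def vecT (s : ℕ) (l : List (ZMod 2)) : Fin s → ZMod 2 := fun i => l.getD i 0

/-- A point of `F₂ˢ` as a valuation of `ℕ`-indexed variables (`0` beyond `s`). [folklore] -/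
def ext {s : ℕ} (x : Fin s → ZMod 2) : ℕ → ZMod 2 := fun i => if h : i < s then x ⟨i, h⟩ else 0

/-- `ext x` on an index `< s`. [folklore] -/
theorem ext_apply_lt {s : ℕ} (x : Fin s → ZMod 2) {i : ℕ} (h : i < s) : ext x i = x ⟨i, h⟩ := by
  simp [ext, h]

/-- `ext x` on a typed index. [folklore] -/
@[simp] theorem ext_val {s : ℕ} (x : Fin s → ZMod 2) (i : Fin s) : ext x i.val = x i := by
  simp [ext, i.isLt]

/-- **The untyped presentation has the same values**: evaluating the `ℕ`-indexed presentation of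
`P : PolyMapF2 s` at `ext x` gives `P.eval x`. [cite: DvirGutfreundRothblumVadhan2010, §2] -/
theorem evalM_untyped {s : ℕ} (P : PolyMapF2 s) (x : Fin s → ZMod 2) :
    evalM (ext x) (P.map (List.map (List.map Fin.val))) = P.eval x := by
  simp [evalM, evalP, PolyMapF2.eval, List.map_map, Function.comp_def]

/-! ### The affine substitution -/

/-- The affine form `Σ_{l < s} A_{il} x_l + b_i` as a sparse polynomial. [cite: Patarin1996, §2] -/
def affForm (s : ℕ) (A : List (List (ZMod 2))) (b : List (ZMod 2)) (i : ℕ) : List (List ℕ) :=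
  ((List.range s).filter fun l => !decide (ent A i l = 0)).map (fun l => [l]) ++
    (if b.getD i 0 = 0 then [] else [[]])

/-- Value of the affine form. [cite: Patarin1996, §2] -/
theorem evalP_affForm (v : ℕ → ZMod 2) (s : ℕ) (A : List (List (ZMod 2))) (b : List (ZMod 2)) (i : ℕ) :
    evalP v (affForm s A b i) = (∑ l ∈ Finset.range s, ent A i l * v l) + b.getD i 0 := by
  rw [affForm, evalP_append]
  congr 1
  · rw [← sum_map_range]
    induction List.range s with
    | nil => rfl
    | cons l L ih =>
      rw [List.filter_cons, List.map_cons, List.sum_cons, ← ih]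
      rcases z2_cases (ent A i l) with h | h
      · simp [h]
      · simp [h, evalP_cons]
  · rcases z2_cases (b.getD i 0) with h | h
    · rw [h]; simp
    · rw [h]; simp [evalP]

/-- The `j`-th factor of the substituted monomial `μ` (`1` past the end). [folklore] -/
def affO (s : ℕ) (A : List (List (ZMod 2))) (b : List (ZMod 2)) (μ : List ℕ) (j : ℕ) : List (List ℕ) :=
  match μ[j]? with
  | some i => affForm s A b i
  | none => [[]]

/-- Substitution of the affine forms into a monomial of degree `≤ 3` (three factors; monomials are
truncated at degree `3`, which is exact under `DegLE 3`). [cite: Patarin1996, §2] -/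
def substMono (s : ℕ) (A : List (List (ZMod 2))) (b : List (ZMod 2)) (μ : List ℕ) : List (List ℕ) :=
  mulP (affO s A b μ 0) (mulP (affO s A b μ 1) (affO s A b μ 2))

/-- Substitution into a polynomial. [cite: Patarin1996, §2] -/
def substP (s : ℕ) (A : List (List (ZMod 2))) (b : List (ZMod 2)) (p : List (List ℕ)) : List (List ℕ) :=
  p.flatMap (substMono s A b)

/-- Value of a factor. [folklore] -/
theorem evalP_affO (v : ℕ → ZMod 2) (s : ℕ) (A : List (List (ZMod 2))) (b : List (ZMod 2)) (μ : List ℕ)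
    (j : ℕ) : evalP v (affO s A b μ j) = (μ[j]?.map fun i => evalP v (affForm s A b i)).getD 1 := by
  unfold affO
  cases μ[j]? with
  | none => simp [evalP]
  | some i => rfl

/-- **Value of a substituted monomial** of degree `≤ 3`: the product of the values of the affine forms
of its variables. [cite: Patarin1996, §2] -/
theorem evalP_substMono (v : ℕ → ZMod 2) (s : ℕ) (A : List (List (ZMod 2))) (b : List (ZMod 2))
    {μ : List ℕ} (hμ : μ.length ≤ 3) :
    evalP v (substMono s A b μ) = (μ.map fun i => evalP v (affForm s A b i)).prod := by
  rw [substMono, evalP_mulP, evalP_mulP, evalP_affO, evalP_affO, evalP_affO]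
  match μ, hμ with
  | [], _ => simp
  | [i], _ => simp
  | [i, j], _ => simp
  | [i, j, l], _ => simp
  | _ :: _ :: _ :: _ :: _, h => simp at h; omega

/-- **Value of a substituted polynomial**: the value of the polynomial at the affine image
`w_i = Σ_l A_{il} v_l + b_i`. [cite: Patarin1996, §2] -/
theorem evalP_substP (v : ℕ → ZMod 2) (s : ℕ) (A : List (List (ZMod 2))) (b : List (ZMod 2))
    {p : List (List ℕ)} (hp : ∀ μ ∈ p, μ.length ≤ 3) :
    evalP v (substP s A b p) = evalP (fun i => evalP v (affForm s A b i)) p := by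
  rw [substP, evalP_flatMap, evalP]
  congr 1
  exact List.map_congr_left fun μ hμ => evalP_substMono v s A b (hp μ hμ)

/-! ### Output mixing and the transform -/

/-- Output `i'` of `B · Q + c`: the sum of the polynomials `Q_i` with `B_{i'i} = 1`, plus `c_{i'}`.
[cite: Patarin1996, §2] -/
def mixP (B : List (List (ZMod 2))) (c : List (ZMod 2)) (Q : List (List (List ℕ))) (i' : ℕ) : List (List ℕ) :=
  ((List.range Q.length).filter fun i => !decide (ent B i' i = 0)).flatMap (fun i => Q.getD i []) ++
    (if c.getD i' 0 = 0 then [] else [[]])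

/-- Value of a mixed output. [cite: Patarin1996, §2] -/
theorem evalP_mixP (v : ℕ → ZMod 2) (B : List (List (ZMod 2))) (c : List (ZMod 2)) (Q : List (List (List ℕ)))
    (i' : ℕ) : evalP v (mixP B c Q i') =
      (∑ i ∈ Finset.range Q.length, ent B i' i * evalP v (Q.getD i [])) + c.getD i' 0 := by
  rw [mixP, evalP_append]
  congr 1
  · rw [← sum_map_range, evalP_flatMap]
    induction List.range Q.length with
    | nil => rfl
    | cons l L ih =>
      rw [List.filter_cons, List.map_cons, List.sum_cons, ← ih]
      rcases z2_cases (ent B i' l) with h | h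
      · simp [h]
      · simp [h]
  · rcases z2_cases (c.getD i' 0) with h | h
    · rw [h]; simp
    · rw [h]; simp [evalP]

/-- **The transform** `(B·+c) ∘ P ∘ (A·+b)` on the sparse presentation (before normalisation).
[cite: Patarin1996, §2] -/
def transform (s : ℕ) (P : List (List (List ℕ))) (A : List (List (ZMod 2))) (b : List (ZMod 2))
    (B : List (List (ZMod 2))) (c : List (ZMod 2)) : List (List (List ℕ)) :=
  (List.range P.length).map fun i' => mixP B c (P.map (substP s A b)) i'

/-- **The normalised transform**: the canonical form of `(B·+c) ∘ P ∘ (A·+b)`. [cite: Patarin1996, §2] -/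
def outMap (s : ℕ) (P : List (List (List ℕ))) (A : List (List (ZMod 2))) (b : List (ZMod 2))
    (B : List (List (ZMod 2))) (c : List (ZMod 2)) : List (List (List ℕ)) :=
  canonM s (transform s P A b B c)

/-- The transform has as many coordinates as `P`. [folklore] -/
@[simp] theorem length_transform (s : ℕ) (P : List (List (List ℕ))) (A : List (List (ZMod 2)))
    (b : List (ZMod 2)) (B : List (List (ZMod 2))) (c : List (ZMod 2)) :
    (transform s P A b B c).length = P.length := by
  simp [transform]

/-- The normalised transform has as many coordinates as `P`. [folklore] -/
@[simp] theorem length_outMap (s : ℕ) (P : List (List (List ℕ))) (A : List (List (ZMod 2)))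
    (b : List (ZMod 2)) (B : List (List (ZMod 2))) (c : List (ZMod 2)) :
    (outMap s P A b B c).length = P.length := by
  simp [outMap]

/-! ### Well-formedness: indices `< s`, degree `≤ 3` -/

/-- Monomials of an affine form: single variables `< s`, or the constant. [folklore] -/
theorem affForm_wf {s : ℕ} {A : List (List (ZMod 2))} {b : List (ZMod 2)} {i : ℕ} {μ : List ℕ}
    (h : μ ∈ affForm s A b i) : (∀ l ∈ μ, l < s) ∧ μ.length ≤ 1 := by
  simp only [affForm, List.mem_append, List.mem_map, List.mem_filter, List.mem_range] at h
  rcases h with ⟨l, ⟨hl, -⟩, rfl⟩ | h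
  · simp [hl]
  · split at h <;> simp_all

/-- Monomials of a factor. [folklore] -/
theorem affO_wf {s : ℕ} {A : List (List (ZMod 2))} {b : List (ZMod 2)} {ν : List ℕ} {j : ℕ} {μ : List ℕ}
    (h : μ ∈ affO s A b ν j) : (∀ l ∈ μ, l < s) ∧ μ.length ≤ 1 := by
  unfold affO at h
  split at h
  · exact affForm_wf h
  · simp_all

/-- Monomials of a product come from concatenation. [folklore] -/
theorem mem_mulP_iff {p q : List (List ℕ)} {μ : List ℕ} :
    μ ∈ mulP p q ↔ ∃ μ₁ ∈ p, ∃ μ₂ ∈ q, μ = μ₁ ++ μ₂ := by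
  simp only [mulP, List.mem_flatMap, List.mem_map]
  exact ⟨fun ⟨a, ha, b, hb, h⟩ => ⟨a, ha, b, hb, h.symm⟩, fun ⟨a, ha, b, hb, h⟩ => ⟨a, ha, b, hb, h.symm⟩⟩

/-- Monomials of a substituted monomial: indices `< s`, length `≤ 3`. [folklore] -/
theorem substMono_wf {s : ℕ} {A : List (List (ZMod 2))} {b : List (ZMod 2)} {ν μ : List ℕ}
    (h : μ ∈ substMono s A b ν) : (∀ l ∈ μ, l < s) ∧ μ.length ≤ 3 := by
  rw [substMono, mem_mulP_iff] at h
  obtain ⟨μ₁, h₁, μ₂₃, h₂₃, rfl⟩ := h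
  obtain ⟨μ₂, h₂, μ₃, h₃, rfl⟩ := mem_mulP_iff.1 h₂₃
  have w₁ := affO_wf h₁; have w₂ := affO_wf h₂; have w₃ := affO_wf h₃
  refine ⟨fun l hl => ?_, ?_⟩
  · simp only [List.mem_append] at hl
    rcases hl with hl | hl | hl
    exacts [w₁.1 l hl, w₂.1 l hl, w₃.1 l hl]
  · simp only [List.length_append]; omega

/-- **Monomials of the transform**: indices `< s`, length `≤ 3` (for every input). [folklore] -/
theorem transform_wf {s : ℕ} {P : List (List (List ℕ))} {A : List (List (ZMod 2))} {b : List (ZMod 2)}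
    {B : List (List (ZMod 2))} {c : List (ZMod 2)} {q : List (List ℕ)} (hq : q ∈ transform s P A b B c)
    {μ : List ℕ} (hμ : μ ∈ q) : (∀ l ∈ μ, l < s) ∧ μ.length ≤ 3 := by
  simp only [transform, List.mem_map, List.mem_range] at hq
  obtain ⟨i', -, rfl⟩ := hq
  simp only [mixP, List.mem_append, List.mem_flatMap, List.mem_filter] at hμ
  rcases hμ with ⟨i, -, hμ⟩ | hμ
  · rw [List.getD_eq_getElem?_getD, List.getElem?_map] at hμ
    cases hP : P[i]? with
    | none => simp [hP] at hμ
    | some p =>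
      simp only [hP, Option.map_some, Option.getD_some, substP, List.mem_flatMap] at hμ
      obtain ⟨ν, -, hν⟩ := hμ
      exact substMono_wf hν
  · split at hμ <;> simp_all

/-- Monomials of the normalised transform: indices `< s`, length `≤ 3`. [folklore] -/
theorem outMap_wf {s : ℕ} {P : List (List (List ℕ))} {A : List (List (ZMod 2))} {b : List (ZMod 2)}
    {B : List (List (ZMod 2))} {c : List (ZMod 2)} {q : List (List ℕ)} (hq : q ∈ outMap s P A b B c)
    {μ : List ℕ} (hμ : μ ∈ q) : (∀ l ∈ μ, l < s) ∧ μ.length ≤ 3 :=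
  canonM_wf hq hμ

end OKit

/-- **Well-formedness of the normalised transform (anchor of the helper file)**: every monomial of
`outMap s P A b B c` uses only variables `< s` and has length `≤ 3`, for every input. [folklore] -/
theorem orbitKit_outMap_wf {s : ℕ} {P : List (List (List ℕ))} {A : List (List (ZMod 2))} {b : List (ZMod 2)}
    {B : List (List (ZMod 2))} {c : List (ZMod 2)} {q : List (List ℕ)} (hq : q ∈ OKit.outMap s P A b B c)
    {μ : List ℕ} (hμ : μ ∈ q) : (∀ l ∈ μ, l < s) ∧ μ.length ≤ 3 :=
  OKit.outMap_wf hq hμ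

end Summit.PneNP.PneNP.Cruxes.PeaWorstToAvg.OrbitPairRsr
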